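/-
Copyright: statement-level skeleton of a published paper (lit-balaban cell, Phase-2 proof seat p39 gen 7). No proof claims
beyond what the kernel checks below.
-/
import Literature.MathematicalPhysics.QuantumFieldTheory.Balaban1983to89.B3KernelConvolutionTorusSup

/-!
# B3 — T. Bałaban, *(Higgs)₂,₃ quantum fields in a finite volume. III. Renormalization*, CMP **88** (1983) 411–445
[Balaban1983Higgs3], p. 441 [PDF 31] with p. 437 [PDF 27]: the BLOCK-SMEARING ESTIMATE behind *"the same equation as in
(3.16)"* on p. 441 — *"If at least one propagator G_{j₀}(0) is replaced by G_{j₀}(0)(1 − m²_{j₀} − a_{j₀}P_{j₀})C^ξ, then we get a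
convergent expression"*: the middle operator `(1 − m² − aP)`, `P = P_k = Q_k^*Q_k` the unit-block projection on the
`ξ = L^{−k}`-lattice, acts on the p. 437 kernels `O(1)e^{−c|y−y′|}/|y − y′|^p` (p = 1, 2) without changing their shape: smearing a
`p`-profile by a unit-block-local kernel gives again a `p`-profile, uniformly in the spacing `0 < ξ ≤ 1` and in the volume

statement-level skeleton of published theorems with citation tags; proofs where landed; nothing here is a claim about
the Yang–Mills mass gap

PDF held: `paper:balaban1983-higgs-2-3-quantum-fields-finite-volume` (journal page = PDF page + 410); pp. 437, 441 read on the
×2 renders `run/shared/lean/pub/pub-balaban/b2b-balaban-ref1/pages/1983-cmp88-higgs23-III/1983-cmp88-higgs23-III-p027-x2.png`,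
`…-p031-x2.png`.  Row **B3.Eq3.25-3.32** of `HOME/lit-balaban-r15/ROWS-B3.md` (fold owner r15): p. 441 [PDF 31] *"Next we replace the
propagator G_{j₀}(0) by C^ξ, ξ = L^{−j₀}, using the same equation as in (3.16). If at least one propagator G_{j₀}(0) is replaced by
G_{j₀}(0)(1 − m²_{j₀} − a_{j₀}P_{j₀})C^ξ, then we get a convergent expression."*; p. 437 [PDF 27]: *"Using the inequalities
|C^ξ(y − y′)| ≦ O(1)e^{−½|y−y′|}/|y − y′|, |G^ξ_{j″}(0; y, y′)| ≦ O(1)e^{−δ₀|y−y′|}/|y − y′|, and the corresponding inequalities for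
derivatives, we can estimate (3.16) by a constant."*  This seat's gen 7 proves the p. 441 sentence for the vector self-energy
functions Π_{μμ′}, Π_{μμ′ν} of (3.26)–(3.30) at the zero-field torus instance; the present file is part of its MODEL-FREE toolkit
(kernels on a torus level `Site P j`, volume element `ξ^d`, `d = 3`, "`p`-profiles" `(ξ·max(1,|y − z|_∞))^{−p}e^{−cξ|y−z|_∞}`,
`|·|_∞` = `supDist` in lattice steps).
* **`smear_le`**: if `|E(z,z′)| ≤ e₁ξ^d`, `E(z,z′) ≠ 0 ⇒ ξ|z − z′| ≤ 2`, `Σ_{z′}|E(z,z′)| ≤ e₂` and `K` has a `p`-profile (constant `b`,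
  rate `β`) whose lattice sum is `≤ S`, then `Σ_{z′}|E(z,z′)||K(z′,y)| ≤ b(4^p e^{4β}e₁S + 2^p e^{2β}e₂)·(ξ·max(1,|z−y|))^{−p}e^{−βξ|z−y|}`
  (near the target the whole lattice sum is used; far from it every `z′` of the block has `ξ|z′ − y| ≥ ½ξ|z − y|`);
  instances **`smear_one_le`**, **`smear_two_le`** (`S` from `B3KernelConvolutionTorusSup.sum_profile_one_le` /
  `B3KernelConvolutionTorus.sum_profile_le`).
File 4 of this seat's gen-7 toolkit (1: `B3TorusRadialTails`, 2: `B3KernelConvolutionTorusSharp`, 3: `B3KernelConvolutionTorusOneTwo`).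
Mathlib + the cited tree files only; theorems only, no definitions, no named facts; standard axioms.  Unit `lit-balaban-p39-g7` (Phase-2 proof seat p39, gen 7),
HOME `run/shared/lean/pub/lit-balaban/`, 2026-08-21.
-/

open scoped BigOperators

namespace Literature.MathematicalPhysics.QuantumFieldTheory.Balaban1983to89.B3KernelBlockSmearing

open LatticeFieldCalculus B3Sect3ScalarSelfEnergy B3TorusRadialSums B3Bound316 B3KernelConvolutionTorus B3KernelConvolutionTorusSup

noncomputable section

variable {P : Params} {j : ℕ}

/-! ## Smearing by a unit-block-local kernel preserves a profile -/

/-- **SMEARING A `p`-PROFILE BY A UNIT-BLOCK-LOCAL KERNEL** (`0 < ξ ≤ 1`): if `|E(z,z′)| ≤ e₁ξ^d`, `E(z,z′) ≠ 0 ⇒ ξ|z − z′|_∞ ≤ 2`,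
`Σ_{z′}|E(z,z′)| ≤ e₂` (e.g. `E = P_k = Q_k^*Q_k` on the `ξ = L^{−k}`-lattice: `|P_k| ≤ ξ^d`, unit blocks, row sums `1`), and `K` has
the profile `|K(z′,y)| ≤ b(ξ·max(1,|z′−y|))^{−p}e^{−βξ|z′−y|}` with lattice sum `Σ_{z′}ξ^d(…) ≤ S`, then for all `z, y`:
`Σ_{z′}|E(z,z′)||K(z′,y)| ≤ b(4^p e^{4β}e₁S + 2^p e^{2β}e₂)·(ξ·max(1,|z−y|))^{−p}e^{−βξ|z−y|}`.  Near the target (`ξ·max(1,|z−y|) ≤ 4`)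
the whole lattice sum is used; far from it every `z′` of the block has `ξ|z′ − y| ≥ ξ|z − y| − 2 ≥ ½ξ|z − y|`. The middle
operator `(1 − m² − aP)` of (3.16) acts on the kernels of p. 437 through this estimate. [cite: Balaban1983Higgs3, (3.16) p.437] -/
theorem smear_le {ξ : ℝ} (hξ : 0 < ξ) (hξ1 : ξ ≤ 1) {β b e₁ e₂ S : ℝ} {p : ℕ} (hβ : 0 < β) (hb : 0 ≤ b)
    (he₁ : 0 ≤ e₁) (he₂ : 0 ≤ e₂) (E K : Kernel P j)
    (hE : ∀ z z' : Site P j, |E z z'| ≤ e₁ * ξ ^ P.d)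
    (hEs : ∀ z z' : Site P j, E z z' ≠ 0 → ξ * (supDist z z' : ℝ) ≤ 2)
    (hE1 : ∀ z : Site P j, ∑ z' : Site P j, |E z z'| ≤ e₂)
    (hK : ∀ z' y : Site P j, |K z' y| ≤
      b * (((ξ * max (1 : ℝ) (supDist z' y : ℝ)) ^ p)⁻¹ * Real.exp (-(β * (ξ * (supDist z' y : ℝ))))))
    (hS : ∀ y : Site P j, ∑ z' : Site P j, ξ ^ P.d * (((ξ * max (1 : ℝ) (supDist z' y : ℝ)) ^ p)⁻¹ *
      Real.exp (-(β * (ξ * (supDist z' y : ℝ))))) ≤ S)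
    (z y : Site P j) :
    ∑ z' : Site P j, |E z z'| * |K z' y| ≤
      b * (4 ^ p * Real.exp (4 * β) * e₁ * S + 2 ^ p * Real.exp (2 * β) * e₂) *
        (((ξ * max (1 : ℝ) (supDist z y : ℝ)) ^ p)⁻¹ * Real.exp (-(β * (ξ * (supDist z y : ℝ))))) := by
  classical
  have hS0 : 0 ≤ S := le_trans (Finset.sum_nonneg fun z' _ => by positivity) (hS y)
  set M : ℝ := max (1 : ℝ) (supDist z y : ℝ) with hM
  have hM1 : 1 ≤ M := le_max_left _ _
  have hM0 : 0 < M := by positivity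
  have hmM : (supDist z y : ℝ) ≤ M := le_max_right _ _
  set prof : ℝ := ((ξ * M) ^ p)⁻¹ * Real.exp (-(β * (ξ * (supDist z y : ℝ)))) with hprof
  have hprof0 : 0 < prof := by positivity
  by_cases hnear : ξ * M ≤ 4
  · -- near: use the whole lattice sum
    have hsum : ∑ z' : Site P j, |E z z'| * |K z' y| ≤ e₁ * b * S := by
      calc ∑ z' : Site P j, |E z z'| * |K z' y|
          ≤ ∑ z' : Site P j, (e₁ * ξ ^ P.d) * (b * (((ξ * max (1 : ℝ) (supDist z' y : ℝ)) ^ p)⁻¹ *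
              Real.exp (-(β * (ξ * (supDist z' y : ℝ)))))) :=
            Finset.sum_le_sum fun z' _ => mul_le_mul (hE z z') (hK z' y) (abs_nonneg _) (by positivity)
        _ = e₁ * b * ∑ z' : Site P j, ξ ^ P.d * (((ξ * max (1 : ℝ) (supDist z' y : ℝ)) ^ p)⁻¹ *
              Real.exp (-(β * (ξ * (supDist z' y : ℝ))))) := by
            rw [Finset.mul_sum]; exact Finset.sum_congr rfl fun z' _ => by ring
        _ ≤ e₁ * b * S := mul_le_mul_of_nonneg_left (hS y) (mul_nonneg he₁ hb)
    -- and `1 ≤ 4^p e^{4β}·prof`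
    have hlow : 1 ≤ 4 ^ p * Real.exp (4 * β) * prof := by
      rw [hprof]
      have h1 : 1 ≤ 4 ^ p * ((ξ * M) ^ p)⁻¹ := by
        rw [← div_eq_mul_inv, one_le_div (by positivity)]
        exact pow_le_pow_left₀ (by positivity) hnear p
      have h2 : 1 ≤ Real.exp (4 * β) * Real.exp (-(β * (ξ * (supDist z y : ℝ)))) := by
        rw [← Real.exp_add]
        apply Real.one_le_exp
        have : β * (ξ * (supDist z y : ℝ)) ≤ β * 4 := by
          refine mul_le_mul_of_nonneg_left ?_ hβ.le
          calc ξ * (supDist z y : ℝ) ≤ ξ * M := mul_le_mul_of_nonneg_left hmM hξ.le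
            _ ≤ 4 := hnear
        linarith
      calc (1 : ℝ) = 1 * 1 := (mul_one 1).symm
        _ ≤ (4 ^ p * ((ξ * M) ^ p)⁻¹) * (Real.exp (4 * β) * Real.exp (-(β * (ξ * (supDist z y : ℝ))))) :=
            mul_le_mul h1 h2 zero_le_one (by positivity)
        _ = _ := by ring
    calc ∑ z' : Site P j, |E z z'| * |K z' y| ≤ e₁ * b * S := hsum
      _ = e₁ * b * S * 1 := (mul_one _).symm
      _ ≤ e₁ * b * S * (4 ^ p * Real.exp (4 * β) * prof) := mul_le_mul_of_nonneg_left hlow (by positivity)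
      _ ≤ b * (4 ^ p * Real.exp (4 * β) * e₁ * S + 2 ^ p * Real.exp (2 * β) * e₂) * prof := by
          have : 0 ≤ b * (2 ^ p * Real.exp (2 * β) * e₂) * prof := by positivity
          nlinarith
  · -- far: every `z′` in the support is at distance `≥ ½ξ|z − y|` from `y`
    push Not at hnear
    have hMm : M = (supDist z y : ℝ) := by
      rw [hM]; refine max_eq_right ?_
      by_contra hlt; push Not at hlt
      have : M = 1 := by rw [hM]; exact max_eq_left hlt.le
      rw [this, mul_one] at hnear; linarith
    have hpt : ∀ z' : Site P j, |E z z'| * |K z' y| ≤ |E z z'| * (b * (2 ^ p * Real.exp (2 * β) * prof)) := by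
      intro z'
      by_cases h0 : E z z' = 0
      · rw [h0, abs_zero, zero_mul, zero_mul]
      · refine mul_le_mul_of_nonneg_left ((hK z' y).trans (mul_le_mul_of_nonneg_left ?_ hb)) (abs_nonneg _)
        have hblk := hEs z z' h0
        have htri : (supDist z y : ℝ) ≤ (supDist z z' : ℝ) + (supDist z' y : ℝ) := supDist_triangle_real z z' y
        have hfar : ξ * M / 2 ≤ ξ * (supDist z' y : ℝ) := by
          rw [hMm]
          have := mul_le_mul_of_nonneg_left htri hξ.le
          rw [hMm] at hnear
          nlinarith
        have hq1 : max (1 : ℝ) (supDist z' y : ℝ) = (supDist z' y : ℝ) := by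
          refine max_eq_right ?_
          by_contra hlt; push Not at hlt
          have hle : ξ * (supDist z' y : ℝ) ≤ ξ * 1 := mul_le_mul_of_nonneg_left hlt.le hξ.le
          rw [mul_one] at hle
          linarith
        rw [hq1]
        have hpow : ((ξ * (supDist z' y : ℝ)) ^ p)⁻¹ ≤ 2 ^ p * ((ξ * M) ^ p)⁻¹ := by
          have e2 : (2 : ℝ) ^ p * ((ξ * M) ^ p)⁻¹ = ((ξ * M / 2) ^ p)⁻¹ := by
            rw [div_pow, inv_div, div_eq_mul_inv]
          rw [e2]
          exact inv_anti₀ (by positivity) (pow_le_pow_left₀ (by positivity) hfar p)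
        have hexp : Real.exp (-(β * (ξ * (supDist z' y : ℝ)))) ≤
            Real.exp (2 * β) * Real.exp (-(β * (ξ * (supDist z y : ℝ)))) := by
          rw [← Real.exp_add]
          apply Real.exp_le_exp.mpr
          have := mul_le_mul_of_nonneg_left htri hξ.le
          nlinarith
        calc ((ξ * (supDist z' y : ℝ)) ^ p)⁻¹ * Real.exp (-(β * (ξ * (supDist z' y : ℝ))))
            ≤ (2 ^ p * ((ξ * M) ^ p)⁻¹) * (Real.exp (2 * β) * Real.exp (-(β * (ξ * (supDist z y : ℝ))))) :=
              mul_le_mul hpow hexp (Real.exp_pos _).le (by positivity)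
          _ = 2 ^ p * Real.exp (2 * β) * prof := by rw [hprof]; ring
    calc ∑ z' : Site P j, |E z z'| * |K z' y| ≤ ∑ z' : Site P j, |E z z'| * (b * (2 ^ p * Real.exp (2 * β) * prof)) :=
          Finset.sum_le_sum fun z' _ => hpt z'
      _ = (∑ z' : Site P j, |E z z'|) * (b * (2 ^ p * Real.exp (2 * β) * prof)) := by rw [Finset.sum_mul]
      _ ≤ e₂ * (b * (2 ^ p * Real.exp (2 * β) * prof)) := mul_le_mul_of_nonneg_right (hE1 z) (by positivity)
      _ ≤ b * (4 ^ p * Real.exp (4 * β) * e₁ * S + 2 ^ p * Real.exp (2 * β) * e₂) * prof := by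
          have : 0 ≤ b * (4 ^ p * Real.exp (4 * β) * e₁ * S) * prof := by positivity
          nlinarith

/-- **Smearing a 1-profile** (`d = 3`, `0 < ξ ≤ 1`): the instance `p = 1` with `S = 1 + radialConst 3 β 1 1`
(`B3KernelConvolutionTorusSup.sum_profile_one_le`). [cite: Balaban1983Higgs3, (3.16) p.437] -/
theorem smear_one_le (hd : P.d = 3) {ξ : ℝ} (hξ : 0 < ξ) (hξ1 : ξ ≤ 1) {β b e₁ e₂ : ℝ} (hβ : 0 < β) (hb : 0 ≤ b)
    (he₁ : 0 ≤ e₁) (he₂ : 0 ≤ e₂) (E K : Kernel P j)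
    (hE : ∀ z z' : Site P j, |E z z'| ≤ e₁ * ξ ^ P.d)
    (hEs : ∀ z z' : Site P j, E z z' ≠ 0 → ξ * (supDist z z' : ℝ) ≤ 2)
    (hE1 : ∀ z : Site P j, ∑ z' : Site P j, |E z z'| ≤ e₂)
    (hK : ∀ z' y : Site P j, |K z' y| ≤
      b * ((ξ * max (1 : ℝ) (supDist z' y : ℝ))⁻¹ * Real.exp (-(β * (ξ * (supDist z' y : ℝ))))))
    (z y : Site P j) :
    ∑ z' : Site P j, |E z z'| * |K z' y| ≤
      b * (4 * Real.exp (4 * β) * e₁ * (1 + radialConst 3 β 1 1) + 2 * Real.exp (2 * β) * e₂) *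
        ((ξ * max (1 : ℝ) (supDist z y : ℝ))⁻¹ * Real.exp (-(β * (ξ * (supDist z y : ℝ))))) := by
  have hK' : ∀ z' y : Site P j, |K z' y| ≤
      b * (((ξ * max (1 : ℝ) (supDist z' y : ℝ)) ^ 1)⁻¹ * Real.exp (-(β * (ξ * (supDist z' y : ℝ))))) := by
    simpa only [pow_one] using hK
  have hS : ∀ y : Site P j, ∑ z' : Site P j, ξ ^ P.d * (((ξ * max (1 : ℝ) (supDist z' y : ℝ)) ^ 1)⁻¹ *
      Real.exp (-(β * (ξ * (supDist z' y : ℝ))))) ≤ 1 + radialConst 3 β 1 1 := by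
    intro y
    have h := sum_profile_one_le hd hξ hξ1 hβ y
    simp only [supDist_comm y] at h
    simp only [pow_one]
    refine h.trans ?_
    rw [hd]; have := radialConst_mono 3 hβ hξ1 1; linarith
  have h := smear_le hξ hξ1 hβ hb he₁ he₂ E K hE hEs hE1 hK' hS z y
  simpa only [pow_one] using h

/-- **Smearing a 2-profile** (`d = 3`, `0 < ξ ≤ 1`): the instance `p = 2` with `S = 1 + radialConst 3 β 1 0`
(`B3KernelConvolutionTorus.sum_profile_le`). [cite: Balaban1983Higgs3, (3.16) p.437] -/
theorem smear_two_le (hd : P.d = 3) {ξ : ℝ} (hξ : 0 < ξ) (hξ1 : ξ ≤ 1) {β b e₁ e₂ : ℝ} (hβ : 0 < β) (hb : 0 ≤ b)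
    (he₁ : 0 ≤ e₁) (he₂ : 0 ≤ e₂) (E K : Kernel P j)
    (hE : ∀ z z' : Site P j, |E z z'| ≤ e₁ * ξ ^ P.d)
    (hEs : ∀ z z' : Site P j, E z z' ≠ 0 → ξ * (supDist z z' : ℝ) ≤ 2)
    (hE1 : ∀ z : Site P j, ∑ z' : Site P j, |E z z'| ≤ e₂)
    (hK : ∀ z' y : Site P j, |K z' y| ≤
      b * (((ξ * max (1 : ℝ) (supDist z' y : ℝ)) ^ 2)⁻¹ * Real.exp (-(β * (ξ * (supDist z' y : ℝ))))))
    (z y : Site P j) :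
    ∑ z' : Site P j, |E z z'| * |K z' y| ≤
      b * (16 * Real.exp (4 * β) * e₁ * (1 + radialConst 3 β 1 0) + 4 * Real.exp (2 * β) * e₂) *
        (((ξ * max (1 : ℝ) (supDist z y : ℝ)) ^ 2)⁻¹ * Real.exp (-(β * (ξ * (supDist z y : ℝ))))) := by
  have hS : ∀ y : Site P j, ∑ z' : Site P j, ξ ^ P.d * (((ξ * max (1 : ℝ) (supDist z' y : ℝ)) ^ 2)⁻¹ *
      Real.exp (-(β * (ξ * (supDist z' y : ℝ))))) ≤ 1 + radialConst 3 β 1 0 := by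
    intro y
    have h := sum_profile_le hd hξ hξ1 hβ y
    simp only [supDist_comm y] at h
    refine h.trans ?_
    rw [hd]; have := radialConst_mono 3 hβ hξ1 0; linarith
  have h := smear_le hξ hξ1 hβ hb he₁ he₂ E K hE hEs hE1 hK hS z y
  norm_num at h ⊢
  exact h

end

end Literature.MathematicalPhysics.QuantumFieldTheory.Balaban1983to89.B3KernelBlockSmearing
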